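import Literature.Probability.LatticeModels.LoomisWhitney
import Literature.Probability.LatticeModels.RCPeierls
import HarnessLib

/-!
# Line-convex lattice sets: the boundary pairs are counted EXACTLY by the shadows,
# `#∂A ≤ 2 Σ_k |π_k A|`

HONEST FRAMING. Part of the venture `Summits/Ventures/Crystal3D` (cell `crystal3d-full`), helper for the
crux `GenericWallFloor` (stmt-Ventures-19480) of `route-Ventures-StickyWulffConstant`, line `WallLedgerG`:
module M1 of the rigid-bicrystal rung of `stub_twoSlabAdhesion` (note RIGID-RUNG-ARCH on the item) bounds
the clamped samples' deficiency from ABOVE; in chart coordinates the deficiency is half the number of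
boundary pairs (`sum_card_stepNeighbors_add_card_boundaryPairs`), and for a CONVEX sample every
coordinate fibre is an integer interval, so each fibre carries exactly one forward and one backward
boundary pair.  This file proves the resulting reverse of the tree's Loomis–Whitney-type bound
`two_mul_sum_card_dropCoord_le_card_boundaryPairs`.  Pure lattice combinatorics on `ℤ^{n+1}`.

* `card_boundaryPairs_filter_le_card_dropCoord` — if the `k`-fibres of `A` are intervals, the boundary
  pairs of direction `(k, b)` inject into the shadow `π_k A` (at most one per fibre).
* `card_boundaryPairs_le_two_mul_sum_card_dropCoord` — hence `#∂A ≤ 2 Σ_k #π_k A` when all fibres are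
  intervals.

WHAT THIS IS NOT: nothing about packings; rung F-C1 not moved.
-/

namespace Summit.Ventures.Crystal3D.Theorems

open Finset
open Literature.Probability.LatticeModels (Site unitStep boundaryPairs mem_boundaryPairs dropCoord
  mem_dropCoord_iff card_boundaryPairs_eq_sum)

variable {n : ℕ}

/-- `x + unitStep k b` changes only the `k`-th coordinate, by `±1`. -/
theorem add_unitStep_eq_update (x : Site (n + 1)) (k : Fin (n + 1)) (b : Bool) :
    x + unitStep k b = Function.update x k (x k + (if b then 1 else -1)) := by
  funext l
  by_cases hl : l = k
  · subst hl; simp [unitStep]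
  · simp [unitStep, hl]

/-- Two sites with the same shadow and the same `k`-th coordinate are equal. -/
theorem eq_of_removeNth_eq_of_apply_eq {x y : Site (n + 1)} {k : Fin (n + 1)}
    (h : Fin.removeNth k x = Fin.removeNth k y) (hk : x k = y k) : x = y := by
  rw [← Fin.insertNth_self_removeNth k x, ← Fin.insertNth_self_removeNth k y, h, hk]

/-- **At most one boundary pair per fibre and direction** when the `k`-fibres of `A` are integer
intervals (`hconv`: with `x, y ∈ A` on the same `k`-fibre, every site of that fibre between them is in `A`). -/
theorem card_boundaryPairs_filter_le_card_dropCoord (A : Finset (Site (n + 1))) (k : Fin (n + 1))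
    (b : Bool)
    (hconv : ∀ x ∈ A, ∀ y ∈ A, Fin.removeNth k x = Fin.removeNth k y →
      ∀ j : ℤ, x k ≤ j → j ≤ y k → Function.update x k j ∈ A) :
    ((boundaryPairs A).filter fun t => t.2 = (k, b)).card ≤ (dropCoord k A).card := by
  classical
  refine Finset.card_le_card_of_injOn (fun t => Fin.removeNth k t.1) (fun t ht => ?_) ?_
  · have ht' := Finset.mem_coe.1 ht
    rw [mem_filter, mem_boundaryPairs] at ht'
    exact Finset.mem_coe.2 (mem_dropCoord_iff.2 ⟨t.1, ht'.1.1, rfl⟩)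
  · intro t ht t' ht' htt'
    rw [mem_coe, mem_filter, mem_boundaryPairs] at ht ht'
    obtain ⟨⟨hx, hxs⟩, hd⟩ := ht
    obtain ⟨⟨hx', hxs'⟩, hd'⟩ := ht'
    -- same direction data
    have hdd : t.2 = t'.2 := by rw [hd, hd']
    have hk1 : t.2.1 = k := by rw [hd]
    have hb1 : t.2.2 = b := by rw [hd]
    have hk1' : t'.2.1 = k := by rw [hd']
    have hb1' : t'.2.2 = b := by rw [hd']
    rw [hk1, hb1] at hxs
    rw [hk1', hb1'] at hxs'
    simp only at htt'
    -- the two sites have the same `k`-th coordinate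
    suffices hkk : t.1 k = t'.1 k by
      exact Prod.ext (eq_of_removeNth_eq_of_apply_eq htt' hkk) hdd
    by_contra hne
    rcases lt_or_gt_of_ne hne with hlt | hgt
    · -- `t.1 k < t'.1 k`
      cases b
      · -- backward step at `t'`: `t'.1 - e_k` lies between, contradiction
        apply hxs'
        rw [add_unitStep_eq_update]
        simp only [Bool.false_eq_true, ↓reduceIte]
        have h := hconv t.1 hx t'.1 hx' htt' (t'.1 k + -1) (by omega) (by omega)
        rwa [show Function.update t.1 k (t'.1 k + -1) = Function.update t'.1 k (t'.1 k + -1) from by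
          rw [← Fin.insertNth_self_removeNth k t.1, ← Fin.insertNth_self_removeNth k t'.1, htt']
          simp] at h
      · -- forward step at `t`: `t.1 + e_k` lies between, contradiction
        apply hxs
        rw [add_unitStep_eq_update]
        simp only [↓reduceIte]
        exact hconv t.1 hx t'.1 hx' htt' (t.1 k + 1) (by omega) (by omega)
    · cases b
      · apply hxs
        rw [add_unitStep_eq_update]
        simp only [Bool.false_eq_true, ↓reduceIte]
        have h := hconv t'.1 hx' t.1 hx htt'.symm (t.1 k + -1) (by omega) (by omega)
        rwa [show Function.update t'.1 k (t.1 k + -1) = Function.update t.1 k (t.1 k + -1) from by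
          rw [← Fin.insertNth_self_removeNth k t.1, ← Fin.insertNth_self_removeNth k t'.1, htt']
          simp] at h
      · apply hxs'
        rw [add_unitStep_eq_update]
        simp only [↓reduceIte]
        exact hconv t'.1 hx' t.1 hx htt'.symm (t'.1 k + 1) (by omega) (by omega)

/-- **Line-convex sets: `#∂A ≤ 2 Σ_k #π_k A`.**  If every coordinate fibre of `A ⊆ ℤ^{n+1}` is an integer
interval, the boundary pairs number at most twice the total shadow count (in fact exactly; the tree's
`two_mul_sum_card_dropCoord_le_card_boundaryPairs` is the other inequality). -/
theorem card_boundaryPairs_le_two_mul_sum_card_dropCoord (A : Finset (Site (n + 1)))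
    (hconv : ∀ k : Fin (n + 1), ∀ x ∈ A, ∀ y ∈ A, Fin.removeNth k x = Fin.removeNth k y →
      ∀ j : ℤ, x k ≤ j → j ≤ y k → Function.update x k j ∈ A) :
    (boundaryPairs A).card ≤ 2 * ∑ k : Fin (n + 1), (dropCoord k A).card := by
  classical
  rw [card_boundaryPairs_eq_sum, Fintype.sum_prod_type, mul_sum]
  refine sum_le_sum fun k _ => ?_
  rw [Fintype.sum_bool, two_mul]
  exact Nat.add_le_add (card_boundaryPairs_filter_le_card_dropCoord A k true (hconv k))
    (card_boundaryPairs_filter_le_card_dropCoord A k false (hconv k))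

end Summit.Ventures.Crystal3D.Theorems
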